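import Mathlib
import Summits.AtomisticToContinuum.Crystallization.Theorems.ChargedEnergyGap.Negative.Unconditional
import Summits.AtomisticToContinuum.Crystallization.Theorems.PalmUnimodularRigidityUnimodularEnergyLowerBoundCluster
import Literature.MathematicalPhysics.StatisticalMechanics.LennardJonesClusters
import HarnessLib

/-! # Window floor `2 e* · #B_L(c) ≤ E_int(B_L(c))` — stub `stub_windowFloor` of line `Sketch`, crux `LjLaminarWindows` (stmt-AtomisticToContinuum-6711) -/

noncomputable section

open scoped BigOperators
open MeasureTheory Metric Filter Topology
open Literature.MathematicalPhysics.StatisticalMechanics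
open Summit.AtomisticToContinuum.Crystallization.Theorems.ChargedEnergyGapNegative

namespace Summit.AtomisticToContinuum.Crystallization.Theorems.LjLaminarWindowsSketch

/-- **Sub-configuration floor.** For an injective configuration `x : Fin N → ℝ³` and any index
set `S`, the double sum of `V_LJ(|x_i - x_k|)` over ORDERED pairs `(i, k) ∈ S²` (diagonal terms
vanish, `V_LJ(0) = 0`) is at least `2 · e* · #S`: it is `2 𝓔(x|_S)` and `#S · e* ≤ 𝓔(x|_S)`
(`card_mul_eStar_le`). [folklore] -/
theorem windowFloor_sum_sum_ge {N : ℕ} {x : Fin N → E3} (hx : Function.Injective x)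
    (S : Finset (Fin N)) :
    2 * eStar * (S.card : ℝ) ≤ ∑ i ∈ S, ∑ k ∈ S, lennardJones (dist (x i) (x k)) := by
  set f := S.orderEmbOfFin rfl with hf
  have hS : Finset.univ.map f.toEmbedding = S := Finset.map_orderEmbOfFin_univ S rfl
  have key := sum_sum_map_eq_two_mul_interactionEnergy lennardJones lennardJones_zero x f.toEmbedding
  rw [hS] at key
  rw [key]
  have h := card_mul_eStar_le (hx.comp f.toEmbedding.injective)
  linarith [h]

/-- **Window floor (stub `stub_windowFloor` of line `Sketch`).** For every finite injective
configuration `x`, every centre `c` and radius `L`, the internal Lennard-Jones energy of the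
particles of `x` in the closed ball `B̄_L(c)` (sum over ordered pairs `j ≠ k`, both within `L`
of `c`) is at least `2 e*` times the number of such particles. [folklore] -/
theorem windowFloor :
    ∀ (N : ℕ) (x : Fin N → E3), Function.Injective x → ∀ (c : E3) (L : ℝ),
      2 * eStar * ((Finset.univ.filter fun j : Fin N => dist (x j) c ≤ L).card : ℝ) ≤
        ∑ j : Fin N, ∑ k : Fin N,
          if j ≠ k ∧ dist (x j) c ≤ L ∧ dist (x k) c ≤ L then lennardJones (dist (x j) (x k)) else 0 := by
  intro N x hx c L
  calc 2 * eStar * ((Finset.univ.filter fun j : Fin N => dist (x j) c ≤ L).card : ℝ)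
      ≤ ∑ i ∈ Finset.univ.filter (fun j : Fin N => dist (x j) c ≤ L),
          ∑ k ∈ Finset.univ.filter (fun j : Fin N => dist (x j) c ≤ L),
            lennardJones (dist (x i) (x k)) :=
        windowFloor_sum_sum_ge hx _
    _ = ∑ j : Fin N, ∑ k : Fin N,
          if j ≠ k ∧ dist (x j) c ≤ L ∧ dist (x k) c ≤ L then lennardJones (dist (x j) (x k))
          else 0 := by
        rw [Finset.sum_filter]
        refine Finset.sum_congr rfl fun j _ => ?_
        rw [Finset.sum_filter]
        by_cases hj : dist (x j) c ≤ L
        · rw [if_pos hj]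
          refine Finset.sum_congr rfl fun k _ => ?_
          by_cases hjk : j = k
          · subst hjk
            simp [lennardJones_zero]
          · simp [hjk, hj]
        · rw [if_neg hj]
          symm
          exact Finset.sum_eq_zero fun k _ => by simp [hj]

end Summit.AtomisticToContinuum.Crystallization.Theorems.LjLaminarWindowsSketch

end
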